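import Mathlib
import HarnessLib
import HarnessLib.Audit
import Summits.HodgeConjecture.Statement
import Literature.AlgebraicGeometry.Motives.FamiliesVHS
import Literature.AlgebraicGeometry.Motives.SurfaceNet
import Summits.HodgeConjecture.HodgeConjecture.Theorems.CurveNetMordellWeilHodgeModels
import Summits.HodgeConjecture.HodgeConjecture.Theorems.CurveNetMordellWeilLefschetzOneOneClose
import HarnessLib.Audit.Status.Attr

/-!
Route: NoetherLefschetzOneUp

DORMANT since 2026-08-27T14:58:16Z (reconciler: no traction for 5.1 d (last activity item-evidence-added at 2026-08-22T11:41:21Z); parked, not closed — `ledger route dormant route-HodgeConjecture-NoetherLefschetzOneUp --off` to reactiva) — unstaffed, not closed; items shared with open routes are served there. `ledger route dormant <id> --off` reactivates.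

# Route NoetherLefschetzOneUp — NL one level up — fourfold Hodge classes through surface nets over
P², K3-type coefficients spanned by NL-Gysin surfaces and multisections, theta-audited

It suffices to show X = K3TypeNets, granted the two CONDITIONAL complements FourfoldsGrantedK3Nets
and SummitGrantedFourfolds (card k3-coefficients-theta-certificate, "Noether–Lefschetz one level
up"; D-0027 §2.1 shape — the deciding theorem `closes` takes exactly the three ranked cruxes and
nothing else): (i) K3TypeNets — for every smooth projective fourfold X with a surjective morphism f
: X → ℙ² whose fibres over the ℂ-points off a proper Zariski-closed subset are smooth projective
surfaces of geometric genus h^{2,0} = 1 (K3-TYPE COEFFICIENTS — K3 and abelian fibres, the card's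
range), the span of the rational (2,2)-classes of X lies in algebraicClasses X 2 ⊔ V_f, where V_f is
the span of the rational (2,2)-classes vanishing on X ∖ f⁻¹(C) for some Zariski-closed C ⊊ ℙ²
(VERTICAL classes). Reading: by Arapura's Leray criterion (Arapura2022 Cor. 1.4, Rmk. 1.6) the one
piece of H⁴(X) that no theorem discharges is the Hodge part of H²(U, 𝕋) ⊂ I_𝕋 = im IH²(ℙ², j_!*𝕋), 𝕋
the transcendental sub-variation of R²f_*ℚ; the algebraic classes there are exactly the NL-GYSIN
classes G_{C,v} (the surface swept by the extra divisor class v the fibres acquire along a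
Noether–Lefschetz curve C ⊂ ℙ²: vertical, algebraic by Lefschetz (1,1) on the threefold f⁻¹(C)) and
the 𝕋-projections of MULTISECTIONS (algebraic); X says they span. (ii) FourfoldsGrantedK3Nets —
granted (i), every rational (2,2)-class on every smooth projective fourfold is algebraic: the
fourfold middle degree off the K3-type sector, reached through a net of constant fibre genus
(support NetReduction), Arapura's level-zero theorem (support LevelZeroNets), the general-type
SUPPLY problem for nets with p_g ≥ 2 (inverse Mumford one level up — the honest boundary of the
mechanism, formerly the typed crux GeneralTypeNets) and the algebraicity of vertical classes
(support VerticalHodgeAlgebraic). (iii) SummitGrantedFourfolds — granted the fourfold middle degree,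
the whole statement: Hodge models exist and every rational (p,p)-class on every smooth projective
complex variety is algebraic — the middle-dimension reduction (support MiddleReduction = BFNP Lemma
48), Lefschetz (1,1) and Hodge models (supports), and the OPEN middle degree of every even dimension
≥ 6, on which the line offers only its reading one level further up (nets of (2m−2)-folds over ℙ²,
K3-type middle variations of higher weight). The complements are stated conditionally (sector below
⇒ sector above) so that neither implies the summit on its own — the unconditional 'middle degree in
every even dimension ≥ 6' does, through X ↦ X × ℙ² (refuter crux-attack on the retired
stmt-HodgeConjecture-14417: RESTATES-THE-TARGET) — and so that the print theorems of the old
nine-hypothesis assembly ride INSIDE the cruxes they serve instead of standing as unproved free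
hypotheses of `closes`.
Lean: `K3TypeNets ∧ FourfoldsGrantedK3Nets ∧ SummitGrantedFourfolds`, with HC42 := ∀ ⦃X :
Literature.AlgebraicGeometry.Motives.SchemeOver ℂ⦄,
Literature.AlgebraicGeometry.Motives.IsSmoothProjective 4 X → ∀ c :
Literature.AlgebraicGeometry.HodgeTheory.complexBetti X (2 * 2),
Literature.AlgebraicGeometry.HodgeTheory.IsRationalClass c →
Literature.AlgebraicGeometry.HodgeTheory.IsOfHodgeType 4 X (2 * 2) 2 2 c → c ∈
Literature.AlgebraicGeometry.HodgeTheory.algebraicClasses X 2; FourfoldsGrantedK3Nets := K3TypeNets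
→ HC42; SummitGrantedFourfolds := HC42 → ∀ ⦃n⦄ ⦃X⦄,
Literature.AlgebraicGeometry.Motives.IsSmoothProjective n X → Nonempty
(Literature.AlgebraicGeometry.HodgeTheory.HodgeModel n X) ∧ ∀ p (c :
Literature.AlgebraicGeometry.HodgeTheory.complexBetti X (2 * p)),
Literature.AlgebraicGeometry.HodgeTheory.IsRationalClass c →
Literature.AlgebraicGeometry.HodgeTheory.IsOfHodgeType n X (2 * p) p p c → c ∈
Literature.AlgebraicGeometry.HodgeTheory.algebraicClasses X p; K3TypeNets as rendered in the route
file (nets f : X ⟶ Literature.AlgebraicGeometry.Motives.projectiveSpace 2 ℂ with Module.finrank ℂ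
(A.hodgePQ 2 2 0) = 1 fibres off a proper closed T).
## Assembly
Crux-only deciding theorem (glue.lean, lean check rc 0 on the gate-rendered file, #h21_check_closes
ok / codes [] / 3 hypotheses, axioms propext · Classical.choice · Quot.sound): `closes (hK3 :
K3TypeNets) (h4 : FourfoldsGrantedK3Nets) (hS : SummitGrantedFourfolds) : HodgeConjecture := fun n X
hX ↦ ⟨(hS (h4 hK3) hX).1, (hS (h4 hK3) hX).2⟩`. The frame item Assembly := K3TypeNets →
HodgeConjecture records 'it suffices to show X' and is proved by `fun h ↦ hS (h4 h)` once the two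
complements land (it is not pure logic: the three-arrow re-currying of `closes` would be, and is
avoided). The six print-theorem supports (LevelZeroNets, VerticalHodgeAlgebraic, NetReduction inside
FourfoldsGrantedK3Nets; MiddleReduction, HodgeModels, LefschetzOneOne inside SummitGrantedFourfolds)
are kept as support items: the foreseen stubs of the complements' lines, provable independently and
no longer load-bearing for `closes`.

Rationale: WHY THIS LINE. Mechanism (card k3-coefficients-theta-certificate): run Arapura's Leray/decomposition
atlas one level up — a SURFACE base with weight-two coefficients (Arapura2022 Thm 1.2, Cor. 1.4–1.5,
READ pp. 2–5) — where for K3-type 𝕋 (h^{2,0} = 1 < 2 = dim B, Green's density condition,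
Green1989NLComponents, Voisin1989NLPetiteCodim) Noether–Lefschetz curves are analytically dense in
ℙ² and sweep a dense geometric supply of honest surfaces G_{C,v}; a Saito bi-type computation
(Saito1990, Popa2017) shows the Mumford-trace components of Hodge classes of I_𝕋 live in H⁰(ℙ²,
Ω²(log Δ_u) ⊗ λ̄⁻¹), which VANISHES over ℙ² whenever the codimension-one degenerations have finite
local monodromy (nodal/ADE: Picard–Lefschetz of order 2) by Kollár's vanishing H²(ℙ², f_*ω_X ⊗ 𝒪(3))
= 0 (Kollar1986 = doi:10.2307/1971351, Thm 2.1) and Serre duality — so every Hodge class of I_𝕋 has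
the middle bi-type (1,1)_B ⊗ (1,1)_𝕋 of NL-Gysin classes, for ANY fibre genus; the only difference
between the K3-type and general-type regimes is the NL SUPPLY. Imported from the arithmetic of
orthogonal groups: the García–Kudla–Millson theta form with Funke–Millson coefficients
(arXiv:1604.03897 Thm 1.2, READ; KudlaMillson1990; arXiv:math/0408050), pulled back along the period
map φ : ℙ²∖Δ → Γ\D_IV, turns 'do NL-Gysin surfaces span?' into the kernel of a vector-valued modular
form of weight rk𝕋/2 — the audit that on Shimura bases IS the theorem 'special cycles span'
(BergeronMillsonMoeglin2016, doi:10.1007/s00222-016-0695-z; Gordon doi:10.1515/crll.1994.449.149 for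
Hilbert–Blumenthal surface bases), transplanted off Shimura varieties with the multisection supply
replacing automorphy. What it does that prior routes do not: CurveNetMordellWeil slices into CURVES
(weight-one/Jacobian coefficients over ℙ^{2p−1}, Mordell–Weil supply), NodalSupport asks for divisor
support with no supply mechanism, KugaSatakeSaturation treats K3 PRODUCTS; here the coefficients are
weight-two of K3 type over a surface, the supply is geometric and dense exactly in this regime, and
completeness has a modular certificate; the negatives index is empty. Scope, stated once: the
mechanism OWNS the K3-type sector (weight-two coefficient systems with h^{2,0} = 1 over a surface
base); the route encompasses the whole summit by listing the two complementary sectors as ranked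
CONDITIONAL cruxes — FourfoldsGrantedK3Nets (K3-type sector ⇒ the fourfold middle degree: net
reduction, Arapura's level zero, vertical classes, and the general-type supply problem where only
the bi-type lemma and the multisections transfer) and SummitGrantedFourfolds (fourfold middle degree
⇒ the statement: middle-dimension reduction, Lefschetz (1,1), Hodge models, and the open middle
degree of every even dimension ≥ 6 where only the one-level-further-up reading transfers) — so that
`closes` is the composite hS ∘ h4 applied to hK3: a ladder by dimension and fibre genus whose
distinctive content is K3TypeNets, with no crux that implies the summit on its own and no unproved
print theorem as a free hypothesis (route-repair 2026-08-16, D-0027 §2.1).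

RANKED CRUXES. #2 K3TypeNets (crux) — K3-TYPE NETS (card K1 + DICHOTOMY, typed shadow). For every
smooth projective fourfold X and surjective f : X → ℙ² whose fibres over the ℂ-points off a proper
Zariski-closed T ⊂ ℙ² are smooth projective surfaces with h^{2,0} = 1 (K3, abelian, and p_g = 1
surfaces in general), span{rational (2,2)-classes} ≤ algebraicClasses X 2 ⊔ span{rational
(2,2)-classes c with c|_(X ∖ f⁻¹C) = 0 for some Zariski-closed C ⊊ ℙ²}. Mechanism reading: Hdg ∩ I_𝕋
= span{G_{C,v} : C an NL curve, v the extra flat (1,1)-class} + span{pr_𝕋[Σ] : Σ a multisection};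
certificate form ker Θ ∩ Hdg ∩ I_𝕋 ⊂ span pr_𝕋[Σ], Θ(ξ) = Σ_m (Σ_{−q(v)/2 = m} ⟨ξ, G_{C_v,v}⟩) q^m
the pulled-back theta series. Over ℙ² with finite local monodromy in codimension one the card's
positivity (V) is automatic (Kollár); first test cases: X_(3,4) ⊂ ℙ²×ℙ³ (CY, quartic K3 fibres),
quadric-section nets of Q⁴, the universal net of quartics X_(1,4). [difficulty: XL] (why it might
fail: A middle-bi-type Hodge class invisible on every NL threefold f⁻¹(C) and every multisection (a
normal function over pencils with no geometric singularity) refutes it; off Shimura-dominated bases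
nothing forces Θ-injectivity; unipotent degenerations re-import inverse Mumford.) [Arapura2022,
Garcia2016, FunkeMillson2006LocalCoefficients, BergeronLiMillsonMoeglin2017,
Gordon1994HilbertBlumenthal, Kollar1986, Green1989NLComponents, KudlaMillson1990, arXiv:1604.03897,
arXiv:math/0408050, card:HodgeConjecture/HodgeConjecture/k3-coefficients-theta-certificate]
#3 FourfoldsGrantedK3Nets (crux) — THE FOURFOLD MIDDLE DEGREE, GRANTED THE K3-TYPE SECTOR
(conditional complement inside dimension 4; replaces the typed GeneralTypeNets
stmt-HodgeConjecture-11601 and absorbs the three print theorems of the net trichotomy). Statement: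
K3TypeNets → for every smooth projective fourfold X, every rational (2,2)-class in H⁴(X(ℂ); ℂ) is
algebraic. How the line reaches it: NetReduction (every fourfold enters through a net X' → ℙ² with
smooth fibres of ONE constant geometric genus g off a proper closed T, algebraicity transferring
back along the blow-up), then by g — g = 0 Arapura's theorem (LevelZeroNets), g = 1 the hypothesis
K3TypeNets, g ≥ 2 GENERAL-TYPE NETS = INVERSE MUMFORD ONE LEVEL UP (the card's K2 boundary: NL
curves have expected codimension p_g ≥ 2 = dim ℙ² and are not dense, so by the DICHOTOMY the supply
is the multisections, i.e. spread-out 0-cycles of the generic fibre X_η over ℂ(ℙ²), which must span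
Hdg ∩ I_𝕋 together with the sporadic NL-Gysin classes; over ℙ² with finite codimension-one monodromy
these Hodge classes are again all of middle bi-type by Kollár, so it is a pure SUPPLY problem for
CH₀(X_η)) — and finally VerticalHodgeAlgebraic (alg ⊔ vertical = alg). Every fourfold lands in the g
≥ 2 branch through a net of high degree, and so do nets on K3 × K3, so granted K3TypeNets this crux
is still the degree-4 Hodge conjecture for all fourfolds; it is stated conditionally so that
K3TypeNets stays load-bearing in `closes` and the crux does not contain the K3 sector twice.
[difficulty: open-problem] (why it might fail: granted K3TypeNets it is still HC(2,2) for every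
fourfold — a general net in |𝒪_X(d)|, d ≫ 0, has p_g ≥ 2 fibres, NL loci of codimension ≥ 2 (no
density, no modular audit), sole supply CH₀(X_η) (Mumford); K3 × K3 with real multiplication lives
here.) [Deligne2000, Arapura2022, Mumford1968RatEquiv, BlochSrinivas1983, VoisinHodgeII2003,
Hartshorne1977]
#4 SummitGrantedFourfolds (crux) — THE SUMMIT, GRANTED THE FOURFOLD MIDDLE DEGREE (conditional
complement beyond dimension 4; replaces SummitBeyondFourfolds stmt-HodgeConjecture-14417, whose
unconditional form 'every rational middle-degree Hodge class in every even dimension ≥ 6 is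
algebraic' implies the whole summit by itself through X ↦ X × ℙ² — refuter crux-attack 2026-08-16,
RESTATES-THE-TARGET — and absorbs the three print theorems of the old assembly's tail). Statement:
(HC in the middle degree of every smooth projective fourfold) → for every n and every smooth
projective n-fold X, a Hodge model of X exists and every rational (p,p)-class on X is algebraic, all
p. How the line reaches it: HodgeModels (conjunct 1), MiddleReduction (BFNP Lemma 48: everything
reduces to the middle degree of even-dimensional varieties — products with projective spaces below
the middle, general slices above), m = 0 trivial (algebraicClasses_zero), m = 1 LefschetzOneOne, m =
2 the hypothesis, m ≥ 3 OPEN — where the line offers only its reading one level further up: a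
2m-fold enters through a net X' → ℙ² of (2m−2)-folds; Arapura's parallelogram over a surface base
isolates IH²(ℙ², j_!*𝕍), 𝕍 ⊂ R^{2m−2}f_* the transcendental middle variation of the fibres, where
the NL-Gysin + multisection supply and the theta audit transfer verbatim WHEN 𝕍 is of K3 type (level
two after a Tate twist, outer Hodge number 1: cubic-fourfold nets on sixfolds, e.g. X ⊂ ℙ²×ℙ⁵ of
bidegree (1,3), Hassett divisors 𝒞_d as the NL curves), next to H⁰(ℙ², R^{2m}f_*) (inverse
Lefschetz, standard conjecture B territory) and H¹(ℙ², j_*R^{2m−1}f_*) (normal functions), for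
which, as for every 𝕍 of level ≥ 4, the line has no supply mechanism. [difficulty: open-problem]
(why it might fail: granted HC(4,2) it is HC in the middle degree of every even dimension ≥ 6 (BFNP
Lem. 48; nothing descends from dimension 4 upward): general Weil-type abelian 2n-folds, n ≥ 3, carry
non-divisorial Hodge classes (vanGeemen1994HodgeAV 4.11), algebraic only for disc −1 sixfolds
(arXiv:2502.03415).) [Deligne2000, BrosnanFangNiePearlstein2009, vanGeemen1994HodgeAV,
Markman2025SecantWeil, arXiv:2502.03415, Arapura2022]
#9 LevelZeroNets (support) — LEVEL ZERO (theorem in print, Arapura2022 Cor. 1.5, READ p. 5): same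
statement for nets whose general fibre has h^{2,0} = 0 — then R²f_* is spanned after a finite base
change by relative divisors 𝒵_i spread from a divisor basis of H²(X_y) by the relative Hilbert
scheme, H²(U, R²) = ⊕ H²(U) ∪ [𝒵_i], and Lefschetz (1,1) on the base finishes (Arapura also recovers
Conte–Murre for uniruled fourfolds). The typed conclusion (algebraic ⊔ vertical) is weaker than the
printed one (HC for X). Stub of FourfoldsGrantedK3Nets (the g = 0 branch) since the 2026-08-16
repair. [difficulty: L] [Arapura2022, ConteMurre1978]
#9 VerticalHodgeAlgebraic (support) — VERTICAL HODGE CLASSES ON A FOURFOLD ARE ALGEBRAIC (theorem in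
print): for X smooth projective of dimension 4 and f : X → ℙ² surjective, the span of the rational
(2,2)-classes vanishing on X ∖ f⁻¹(C), C ⊊ ℙ² Zariski-closed, lies in algebraicClasses X 2. Proof:
ker(H⁴(X) → H⁴(X ∖ f⁻¹C)) is the sum of the Gysin images of H²(D̃_j)(−1) over resolutions D̃_j of
the components of the threefold f⁻¹(C) (Deligne, Hodge III 8.2.8); a Hodge class in the image lifts
to Hodge classes on the D̃_j by semisimplicity of polarisable Hodge structures; these are divisor
classes (Lefschetz (1,1)) and push forward to algebraic classes. In-tree path:
SupportedHodgeClassDescent.supportedHodgeClass_mem_algebraicClasses_of_hodgeConjectureFor_lt with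
LefschetzOneOne.hodgeClasses_algebraic_of_dim_le_three. This is the item through which the NL-Gysin
classes G_{C,v} (Lefschetz (1,1) on the K3-threefold over an NL curve) become algebraic; since the
2026-08-16 repair it is a stub of FourfoldsGrantedK3Nets, not a hypothesis of `closes`. [difficulty:
M] [DeligneHodgeIII1974, VoisinHodgeII2003, Zucker1977]
#9 NetReduction (support) — EVERY FOURFOLD ENTERS THROUGH A NET (theorem in print): for X smooth
projective of dimension 4 there are a smooth projective fourfold X' (the blow-up of X along the
smooth base curve of a general net in |𝒪_X(d)|, Hartshorne II 7.17.3 + Bertini) and a surjective f :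
X' → ℙ² whose fibres off a proper Zariski-closed T ⊂ ℙ² are smooth projective surfaces (generic
smoothness) admitting Hodge models with h^{2,0} equal to one CONSTANT g (Hodge numbers are constant
in smooth projective families: Ehresmann + upper semicontinuity + Hodge symmetry), such that
algebraicity of all rational (2,2)-classes of X' implies that of all rational (2,2)-classes of X
(σ_* σ^* = id on H⁴(X), σ^* preserves rational Hodge classes, σ_* preserves algebraic classes). The
prover chooses the net: d ≫ 0 always gives g ≥ 2; g = 1 nets exist on special X (quadric sections of
Q⁴, the projection of X_(3,4) ⊂ ℙ²×ℙ³, K3-fibred Fano/CY fourfolds), g = 0 on uniruled-type X. Stub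
of FourfoldsGrantedK3Nets since the 2026-08-16 repair. [difficulty: L] [Hartshorne1977,
VoisinHodgeII2003, Fulton1998]
#9 MiddleReduction (support) — REDUCTION TO THE MIDDLE DIMENSION (Literature named fact
middleDimensionReduction = BrosnanFangNiePearlstein2009 Lemma 48): if every rational middle-degree
Hodge class on every even-dimensional smooth projective complex variety is algebraic, then every
rational (p,p)-class on every smooth projective variety is. In tree modulo three tier-0 facts
(nonempty_hodgeModel, hodgePQ_independent_of_hodgeModel, CupPreservesHodgeType):
MiddleDimensionReductionOfHodgeModels.middleDimensionReduction_of_nonempty_hodgeModel — products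
with projective spaces below the middle, general slices of X × (ℙ¹)^r above it. Stub of
SummitGrantedFourfolds since the 2026-08-16 repair. [difficulty: provable-now]
[BrosnanFangNiePearlstein2009, KerrPearlstein2011]
#9 HodgeModels (support) — HODGE MODELS EXIST (conjunct 1 of HodgeConjectureFor; the Literature fact
nonempty_hodgeModel restated as the route's own obligation, verbatim the signature of
CurveNetMordellWeil.HodgeModels so that the item is shared): every smooth projective complex variety
has a Hodge model (Serre GAGA analytification + de Rham + Hodge decomposition on a compact Kähler
manifold). Stub of SummitGrantedFourfolds (conjunct 1) since the 2026-08-16 repair. [difficulty: M]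
[SerreGAGA1956, VoisinHodgeI2002]
#9 LefschetzOneOne (support) — LEFSCHETZ (1,1), rational form (the Literature fact
lefschetzOneOne_rational restated as the route's obligation, verbatim the signature of
CurveNetMordellWeil.LefschetzOneOne so that the item is shared): every rational (1,1)-class on a
smooth projective complex variety is a ℂ-combination of divisor classes. Used for the middle degree
of surfaces (m = 1) inside SummitGrantedFourfolds. [difficulty: M] [VoisinHodgeI2002, Deligne2000]

TWO-LAYER PLAN. Foreseen glued splits (nothing filed now). K3TypeNets ⇐ K3NetsFiniteMonodromy (all
codimension-one degenerations with finite local monodromy: the (V)-automatic case over ℙ²) →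
K3NetsUnipotent (log poles along Δ_u: the Mumford-trace components must be traces of multisections)
→ K3TypeNets. Then K3NetsFiniteMonodromy ⇐ NLSpanModMultisections (ker Θ ∩ Hdg ∩ I_𝕋 ⊂ span pr_𝕋[Σ])
→ ThetaCertificate (Θ(ξ) is the ξ-component of φ*(García–Funke–Millson form), holomorphic
vector-valued modular of weight rk𝕋/2, m-th coefficient Σ⟨ξ, G_(C_v,v)⟩ with excess multiplicities)
→ K3NetsFiniteMonodromy, with ONE engine child chosen among (e1) Shimura-dominated bases rk𝕋 ≤ 4
(BLMM / Hirzebruch–Zagier with coefficients + Lefschetz for the finite period map), (e2) NL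
persistence = Hodge locus in families of nets (IVHS), (e3) all-frequency equidistribution of
weighted NL currents (Tayou–Tholozan type, arXiv:2103.15717). The complements split along their
absorbed structure, only after K3TypeNets moves: FourfoldsGrantedK3Nets ⇐ GeneralTypeNetsTyped (crux
child: nets with p_g ≥ 2 fibres, span ≤ algebraic ⊔ vertical — the retired stmt-11601 text,
refuter-vetted 2026-08-15) + NetTrichotomyGlue (support child: NetReduction ∧ LevelZeroNets ∧
VerticalHodgeAlgebraic ⇒ (K3TypeNets → GeneralTypeNetsTyped → HC(4,2))); SummitGrantedFourfolds ⇐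
HigherMiddleDegrees (crux child, conditional ladder form: HC in the middle degree of dimension 2m
granted all even dimensions below, m ≥ 3) + MiddleReductionGlue (support child: HodgeModels ∧
MiddleReduction ∧ LefschetzOneOne ⇒ the rest).

KILL CRITERIA. A refutation of K3TypeNets or FourfoldsGrantedK3Nets is a counterexample to the Hodge
conjecture on a fourfold, a refutation of SummitGrantedFourfolds one in dimension ≥ 6 (the classical
candidates: general Weil-type abelian 2n-folds, n ≥ 3, vanGeemen1994HodgeAV Thm 4.11) — in each case
close `refuted:<Decl>`, hand the witness to the summit's negative side, and bank whatever is proved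
of the fourfold sector (K3TypeNets with VerticalHodgeAlgebraic ⇒ HC for K3-fibred fourfolds over ℙ²;
K3TypeNets ∧ FourfoldsGrantedK3Nets ⇒ HC in degree 4) as a Theorems result. Realistic pivots rather
than kills: (a) if the pulled-back theta series fails to be modular with the NL-Gysin coefficients
off arithmetic quotients (García's Thm 1.2 needs Γ_L\D; pull-back along φ is formal, but excess
components of φ(ℙ²) ∩ D_v may spoil holomorphy), the AUDIT dies and K3TypeNets is attacked through
engines (e2)/(e3) only; (b) if the calibration on the universal net of quartics shows Θ(E_i − E_j) ≡
0 (all 64 sections in ker Θ), 'NL-Gysin alone spans' is false already where HC is trivially true and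
the multisection summand is confirmed load-bearing — expected, recorded, not a kill; (c) a printed
theorem giving HC for all K3-fibred fourfolds over ℙ² downgrades the route to known (close
superseded, bank the reduction items). LevelZeroNets / VerticalHodgeAlgebraic / NetReduction /
MiddleReduction are theorems in print: a refutation of their typed form means a mis-typing (repair
by restating, not a pivot).

NOT DECOMPOSED YET. The bi-type / Mumford-trace lemma and the theta-certificate lemma (filed after
open as informal support items: intersection cohomology with coefficients, Hodge modules and
vector-valued modular forms have no carriers in Mathlib); the engines (e1)–(e3) (informal crux, one
suffices on its range); abelian-surface fibres' extra Leray pieces IH¹(R³) = L·Mordell–Weil and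
IH³(R¹) (inside K3TypeNets as typed, h^{2,0} = 1 covers them); K3-type fibrations over bases other
than ℙ² — rational bases reduce to ℙ² by blowing up, K_B-positive or isotrivial bases (S × B, p_g(B)
> 0: Hom_HS(T(S),T(B)), real multiplication on K3 × K3) are the card's K2 boundary and deliberately
NOT an item; the PARITY theorem for fibre powers of K3 families over complete curves (card P4,
bankable unconditional companion: n ≤ rk𝕋 − 1) is left for tenure as a Theorems target; constancy of
h^{2,0} and the blow-up bookkeeping are inside NetReduction, not separate items.
SummitGrantedFourfolds is not split: its only foreseen child inside the mechanism's range — K3-type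
nets of higher weight (cubic-fourfold / Gushel–Mukai nets on sixfolds, Hassett divisors as NL
curves) glued to a complementary higher-level item — is filed only after K3TypeNets moves, exactly
like the FourfoldsGrantedK3Nets split; the retired typed statements GeneralTypeNets (stmt-11601) and
SummitBeyondFourfolds (stmt-14417) survive as the texts of those foreseen children.

CHEAPEST FALSIFIER. Literature first (run this session as far as services allowed): Arapura2022 READ
— Cor. 1.5 is p_g = 0 only, Rmk. 1.6 / Cor. 2.4 handle K3-type 𝕋 only when Hdg(H²(U,𝕋)(2)) = 0 (ρ =
19 elliptic K3 families), so spanning WHEN Hodge classes exist is not in print there; still to check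
by a refuter with library access: Gordon, Crelle 449 (1994) §§4–5 (doi:10.1515/crll.1994.449.149)
and BLMM 2017 §1 for a statement covering non-Shimura surface bases — if found, grade known.
Computation second (kit-sized, not run: planners do not hold compute in plancard mode): on the
universal net of quartics X_(1,4) ⊂ ℙ²×ℙ³ (HC trivially true; λ̄ = 𝒪(1), 64 base-point sections E_i
≅ ℙ², nodal discriminant) compute the first coefficients of Θ(E_i − E_j) = Σ_v [#{s ∈ C_v : x_i ∈
curve_v(s)} − #{… x_j …}] q^m over the NL curves of quartics containing a line / a conic; all zero ⇒
sections sit in ker Θ and the multisection summand of K3TypeNets is load-bearing already in the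
calibration case. For the two conditional complements nothing cheaper than the summit's own negative
programme exists (FourfoldsGrantedK3Nets: nets on K3 × K3 with real multiplication;
SummitGrantedFourfolds: Weil-type abelian sixfolds of discriminant ≠ −1) — recorded; the summit's
standing refuters own those witnesses.

NUMBERS. Green's density condition for NL loci of a weight-two variation over a base B: h^{2,0} ≤
dim B, here 1 ≤ 2 (K3 type) versus p_g ≥ 2 (general type: expected codimension p_g, no density).
Weight of the certificate Θ: rk𝕋/2 (García Thm 1.2: dim V/2; rk𝕋 = 21 for quartic nets of Picard
rank 1, = 22 − ρ_gen in general). Arapura's parallelogram for dim X = 4, dim Y = 2: the single Leray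
spot with p > 1 is (p,i) = (2,2) (Cor. 1.4). Picard–Lefschetz order 2 at nodal surface degenerations
(even fibre dimension) ⇒ no log pole; Kollár: H^j(ℙ², R^i f_*ω_X ⊗ 𝒪(k)) = 0 for j > 0, k ≥ 1, so
H²(ℙ², f_*ω_(X/ℙ²)) = 0 and H⁰(ℙ², K ⊗ λ̄∨) = 0. Calibration data: X_(3,4) ⊂ ℙ²×ℙ³ has λ̄ = 𝒪(3),
K_B ⊗ λ̄⁻¹ = 𝒪(−6); X_(1,4) has λ̄ = 𝒪(1) and 4³ = 64 sections. Items at open: 10; after the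
2026-08-16 route-repair 13 active ≤ 15: 3 ranked cruxes (K3TypeNets #2; FourfoldsGrantedK3Nets #3
and SummitGrantedFourfolds #4, the conditional complements replacing GeneralTypeNets stmt-11601 and
SummitBeyondFourfolds stmt-14417), 9 support (LevelZeroNets, VerticalHodgeAlgebraic, NetReduction,
MiddleReduction, HodgeModels, LefschetzOneOne in print / provable — stubs of the complements, no
longer hypotheses of `closes`; NLEngines, ThetaCertificate, MumfordTraceVanishing informal —
NLEngines is an engines MENU for K3TypeNets, filed informal at rank 4 but kind support, not a
staffing key), 1 assembly (frame #1 K3TypeNets → HodgeConjecture); `closes` has exactly 3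
hypotheses; 1 definition request, 1 cite fact.

DEFINITION REQUESTS. D1 `SurfaceNet` (topic Literature/AlgebraicGeometry/Motives): the
relative-dimension-two analogue of Motives.CurveNet over ℙ² — total space smooth projective of
dimension 4, blow-down to X off a closed base curve, proj : total ⟶ ℙ² with geometrically connected
fibres, smooth of relative dimension 2 where smooth, discriminant / smoothBase API, and the constant
geometric genus of the smooth fibres; would let K3TypeNets / NetReduction be restated over a
structure. D2 `NoetherLefschetzGysinClass` (topic Literature/AlgebraicGeometry/HodgeTheory, after
D1): for a SurfaceNet, a closed curve C ⊂ ℙ² and a flat family of extra rational (1,1)-classes v on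
the fibres over C, the class in complexBetti total 4 of the swept surface (Gysin of the divisor
class on a resolution of proj⁻¹C) — the G_(C,v) of the thesis; HodgeLocus.lean already names the
loci. Cite fact wanted: Kollár 1986 Thm 2.1 (ii) (doi:10.2307/1971351): H^j(Y, R^i f_*ω_X ⊗ L) = 0
for j > 0, L ample, f : X → Y surjective from smooth projective X — the vanishing behind 'positivity
(V) is automatic over ℙ²'.

Novelty: Searches (2026-08-15): `lit frontier HodgeConjecture --since 2021` (30 rows: Hodge loci / abelian
sixfolds / integral Tate — none on fibred fourfolds or NL with coefficients); `lit search --source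
arxiv`: "Hodge cycles Leray filtration fibred variety" (1: arXiv:2103.05038 = Arapura2022, READ pp.
2–5, 9–10), "Hodge conjecture K3 fibration fourfold" (1: arXiv:1710.05753 cubic-fourfold motive,
unrelated), "Gromov-Witten theory and Noether-Lefschetz theory" (5: arXiv:0705.1653,
arXiv:0807.2477, arXiv:2102.11622, arXiv:2506.12438, arXiv:1809.06945 READ intro — NL NUMBERS of
K3-fibred threefolds / elliptic fibrations over surfaces, enumerative, no Hodge classes of the total
space), "superconnections theta series period domains" (1: arXiv:1604.03897 READ §1, Thm 1.1–1.2),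
"Hodge type theorems arithmetic manifolds orthogonal groups" (1: arXiv:1110.3049), "equidistribution
Hodge loci Tayou Tholozan" (1: arXiv:2103.15717), "Noether-Lefschetz locus surfaces fourfolds" (1:
arXiv:2007.15590, special cubic fourfolds, unrelated); `lit galaxy search "Noether-Lefschetz Hodge
conjecture fibred fourfold" --star all` (0 rows); `lit search --hybrid` / local index: searchd
unavailable all session (noted in NOTES.md); OpenAlex: daily budget exhausted; `ledger negatives
--problem HodgeConjecture` (0); routed cards (34) and Theses/ (47 route files) scanned by hand:
nearest in-house CurveNetMordellWeil (weight-one coefficients), NodalSupport (divisor support),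
KugaSatakeSaturation (K3 products), Deriv  [refs: 10.1515/crll.1994.449.149, 10.1007/s00222-016-0695-z, 2103.05038, 1710.05753, 0705.1653, 0807.2477, 2102.11622, 2506.12438, 1809.06945, 1604.03897, 1110.3049, 2103.15717, 2007.15590, math/0408050, doi:10.1515/crll.1994.449.149, doi:10.1007/s00222-016-0695-z, Arapura2022, BergeronLiMillsonMoeglin2017, BergeronMillsonMoeglin2016, Garcia2016, KudlaMillson1990, Kollar1986]

Barriers (technique_class: leray-decomposition, nl-gysin, theta-lift): - technique_class: leray-decomposition, nl-gysin, theta-lift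
- Literature.Barriers.HodgeConjecture.Voisin2003_generalHypersurface_noIntegralClassInF: restricted
to a pencil ℓ ⊂ ℙ², I_𝕋 embeds in the normal-function group H¹(ℓ, H¹(C_t, 𝕋)) of a weight-three
variation whose Jacobians have no algebraic part — the barrier's home turf — but no Abel–Jacobi
inversion is attempted: cycles are SUPPLIED (NL-Gysin surfaces by Lefschetz (1,1) on threefolds,
multisections) and modularity only audits completeness; the barrier is conceded to bite in
GeneralTypeNets, where the supply must come from CH₀ of the generic fibre.
- Literature.Barriers.HodgeConjecture.Grothendieck1969_generalHodgeConjecture_false: no coniveau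
statement beyond what HC predicts — 'vertical' (N¹ off f⁻¹C) is claimed only for Hodge classes
modulo algebraic ones; Leray / decomposition-theorem projectors LOCATE classes and are never
asserted algebraic.
- Literature.Barriers.HodgeConjecture.CattaniDeligneKaplan1995_hodgeLocus_algebraicFor: used
positively — NL curves are algebraic (Hodge loci of the net), so the swept G_(C,v) are classes of
algebraic surfaces, and engine (e2) compares two algebraic loci.
- Literature.Barriers.HodgeConjecture.Mumford1968_simpleFourfold_exceptionalHodgeClasses (and Weil's
1977 exceptional classes): abelian-surface fibres — exceptional classes of single fibres are not
flat under big monodromy and do not enter I_𝕋; families with unitary (CM/QM) monodromy carry extra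
flat classes that are fibr

History (route lifecycle, newest last):
- 2026-08-15T18:30:07Z · rev 1: restated MiddleReduction (stmt-HodgeConjecture-11605) — unfold MiddleReduction: the item referenced the cite-only constant middleDimensionReduction, which made deps.unproved non-empty (staffable=false); statement is (planner-plancard-HodgeConjecture-HodgeConject-08f7b598-0)
- 2026-08-16T02:19:05Z · AUTO-CRUX: 1 conjecture-grade item(s) promoted to crux (SummitBeyondFourfolds) — refuter vetting / tiering apply (operator:999:1362873)
- 2026-08-16T03:03:41Z · rev 4: restated SummitBeyondFourfolds (stmt-HodgeConjecture-11606) — @note1.txt (planner-rbadge-HodgeConjecture-NoetherLefschet-8ba4d6b7-0)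
- 2026-08-16T03:22:56Z · rev 5: restated Assembly (stmt-HodgeConjecture-14134) — reconcile two concurrent route-choice edits (race: rbadge rev 4 at 03:03:41Z vs this seat's edit at 03:04:26Z; both chose option (a) = claim the dimension >= 6 (planner-rchoice-HodgeConjecture-NoetherLefsche-c191b1b4-0)
- 2026-08-16T03:22:56Z · rev 5: dropped MiddleDegreeBeyondFourfolds — reconcile two concurrent route-choice edits (race: rbadge rev 4 at 03:03:41Z vs this seat's edit at 03:04:26Z; both chose option (a) = claim the dimension >= 6 (planner-rchoice-HodgeConjecture-NoetherLefsche-c191b1b4-0)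
- 2026-08-16T04:01:18Z · rev 10: restated Assembly (stmt-HodgeConjecture-14416) — route-repair (rbadge g2, D-0027 §2.1 glue.non-crux-hypothesis + partial-claim hold): make `closes` CRUX-ONLY. (1) ADD two conditional complements as ranked crux (planner-rbadge-HodgeConjecture-NoetherLefschet-8ba4d6b7-g2-0)
- 2026-08-16T04:01:18Z · rev 10: dropped GeneralTypeNets, SummitBeyondFourfolds — route-repair (rbadge g2, D-0027 §2.1 glue.non-crux-hypothesis + partial-claim hold): make `closes` CRUX-ONLY. (1) ADD two conditional complements as ranked crux (planner-rbadge-HodgeConjecture-NoetherLefschet-8ba4d6b7-g2-0)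
- 2026-08-27T14:58:16Z · DORMANT — reconciler: no traction for 5.1 d (last activity item-evidence-added at 2026-08-22T11:41:21Z); parked, not closed — `ledger route dormant route-HodgeConjecture- (operator:999:1404316)

sub-problem: HodgeConjecture · status: dormant · opened planner-plancard-HodgeConjecture-HodgeConject-08f7b598-0 2026-08-15T18:27:20Z · rev 11 · ledger route-HodgeConjecture-NoetherLefschetzOneUp
GENERATED by the gate from the ledger (D-0016/17). Provers cite these decls: `theorem foo : Summit.HodgeConjecture.HodgeConjecture.Theses.NoetherLefschetzOneUp.<Decl> := …` in Summits/HodgeConjecture/HodgeConjecture/Theorems/<Name>.lean.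
-/

namespace Summit.HodgeConjecture.HodgeConjecture.Theses.NoetherLefschetzOneUp

open scoped BigOperators Topology Manifold Classical MeasureTheory ProbabilityTheory Matrix InnerProductSpace ComplexConjugate ContinuousMap
open Filter Set Function TopologicalSpace MeasureTheory

attribute [summit_statement] _root_.HodgeConjecture

/-- item stmt-HodgeConjecture-11600 · crux · rank 2 · open · by planner
why it might fail: h^{2,0}=1 admits abelian fibres: for S an elliptic K3 with real multiplication (VanGeemen2008RM §3) Bl(S×S)→ℙ² with fibres E_s×E_t is such a net, so the crux contains HC(S×S) with RM classes in T(S)⊗T(S) ⊂ H²(U,𝕋), open (Huybrechts2019 Rem 3.3); nothing there forces NL-Gysin+multisections to span.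
sources: Arapura2022, Huybrechts2019, VanGeemen2008RM, Schlickewei2010, Garcia2016, FunkeMillson2006LocalCoefficients
[crux] K3-TYPE NETS (card K1 + DICHOTOMY, typed shadow). For every smooth projective fourfold X and
surjective f : X → ℙ² whose fibres over the ℂ-points off a proper Zariski-closed T ⊂ ℙ² are smooth
projective surfaces with h^{2,0} = 1 (K3, abelian, and p_g = 1 surfaces in general), span{rational
(2,2)-classes} ≤ algebraicClasses X 2 ⊔ span{rational (2,2)-classes c with c|_(X ∖ f⁻¹C) = 0 for
some Zariski-closed C ⊊ ℙ²}. Mechanism reading: Hdg ∩ I_𝕋 = span{G_{C,v} : C an NL curve, v the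
extra flat (1,1)-class} + span{pr_𝕋[Σ] : Σ a multisection}; certificate form ker Θ ∩ Hdg ∩ I_𝕋 ⊂
span pr_𝕋[Σ], Θ(ξ) = Σ_m (Σ_{−q(v)/2 = m} ⟨ξ, G_{C_v,v}⟩) q^m the pulled-back theta series. Over ℙ²
with finite local monodromy in codimension one the card's positivity (V) is automatic (Kollár);
first test cases: X_(3,4) ⊂ ℙ²×ℙ³ (CY, quartic K3 fibres), quadric-section nets of Q⁴, the universal
net of quartics X_(1,4). [difficulty: XL] -/
@[route_item "route-HodgeConjecture-NoetherLefschetzOneUp", crux]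
def K3TypeNets : Prop :=
  ∀ ⦃X : Literature.AlgebraicGeometry.Motives.SchemeOver ℂ⦄ (f : X ⟶ Literature.AlgebraicGeometry.Motives.projectiveSpace 2 ℂ), Literature.AlgebraicGeometry.Motives.IsSmoothProjective 4 X → Function.Surjective f.left.base → (∃ T : Set (Literature.AlgebraicGeometry.Motives.projectiveSpace 2 ℂ).left, IsClosed T ∧ T ≠ Set.univ ∧ ∀ s : Literature.AlgebraicGeometry.Motives.AlgPoints (Literature.AlgebraicGeometry.Motives.projectiveSpace 2 ℂ) ℂ, s.pt ∉ T → Literature.AlgebraicGeometry.Motives.IsSmoothProjective 2 (Literature.AlgebraicGeometry.Motives.fiberOver f s) ∧ ∃ A : Literature.AlgebraicGeometry.HodgeTheory.HodgeModel 2 (Literature.AlgebraicGeometry.Motives.fiberOver f s), Module.finrank ℂ ↥(A.hodgePQ 2 2 0) = 1) → Submodule.span ℂ {c : Literature.AlgebraicGeometry.HodgeTheory.complexBetti X (2 * 2) | Literature.AlgebraicGeometry.HodgeTheory.IsRationalClass c ∧ Literature.AlgebraicGeometry.HodgeTheory.IsOfHodgeType 4 X (2 * 2) 2 2 c} ≤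 Literature.AlgebraicGeometry.HodgeTheory.algebraicClasses X 2 ⊔ Submodule.span ℂ {c : Literature.AlgebraicGeometry.HodgeTheory.complexBetti X (2 * 2) | Literature.AlgebraicGeometry.HodgeTheory.IsRationalClass c ∧ Literature.AlgebraicGeometry.HodgeTheory.IsOfHodgeType 4 X (2 * 2) 2 2 c ∧ ∃ T : Set (Literature.AlgebraicGeometry.Motives.projectiveSpace 2 ℂ).left, IsClosed T ∧ T ≠ Set.univ ∧ Literature.AlgebraicGeometry.HodgeTheory.complexBetti.restrictCompl X (f.left.base ⁻¹' T) (2 * 2) c = 0}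

/-- item stmt-HodgeConjecture-14599 · crux · rank 3 · open · by planner
why it might fail: Granted K3TypeNets it is still HC(2,2) for every fourfold: a general net in |O_X(d)|, d ≫ 0, has p_g ≥ 2 fibres, NL loci of codim ≥ 2 (no density, no modular audit), sole supply CH₀(X_η) (Mumford 1968); K3×K3 with real multiplication lives here.
sources: Deligne2000, Arapura2022, Mumford1968RatEquiv, BlochSrinivas1983, VoisinHodgeII2003, Hartshorne1977
[crux] THE FOURFOLD MIDDLE DEGREE, GRANTED THE K3-TYPE SECTOR (rank 3; conditional complement inside
dimension 4 — D-0027 §2.1 route-repair 2026-08-16: replaces the typed GeneralTypeNets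
stmt-HodgeConjecture-11601 and absorbs the print theorems NetReduction / LevelZeroNets /
VerticalHodgeAlgebraic, which stay as support items = the foreseen stubs of this crux). Statement:
K3TypeNets → every rational (2,2)-class on every smooth projective complex fourfold is algebraic.
How the line reaches it: every fourfold enters through a net X' → ℙ² whose smooth fibres off a
proper closed T have ONE constant geometric genus g, algebraicity transferring back along the
blow-up (NetReduction); g = 0 is Arapura's theorem (LevelZeroNets, Arapura2022 Cor. 1.5); g = 1 is
the hypothesis K3TypeNets; g ≥ 2 is GENERAL-TYPE NETS = INVERSE MUMFORD ONE LEVEL UP (the card's K2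
boundary: NL curves have expected codimension p_g ≥ 2 = dim ℙ² and are not dense, so by the
DICHOTOMY the supply is the multisections — spread-out 0-cycles of the generic fibre X_η over ℂ(ℙ²)
— which must span Hdg ∩ I_𝕋 together with the sporadic NL-Gysin classes; over ℙ² with finite
codimension-one monodromy these Hodge classes are all -/
@[route_item "route-HodgeConjecture-NoetherLefschetzOneUp", crux]
def FourfoldsGrantedK3Nets : Prop :=
  K3TypeNets → ∀ ⦃X : Literature.AlgebraicGeometry.Motives.SchemeOver ℂ⦄, Literature.AlgebraicGeometry.Motives.IsSmoothProjective 4 X → ∀ c : Literature.AlgebraicGeometry.HodgeTheory.complexBetti X (2 * 2), Literature.AlgebraicGeometry.HodgeTheory.IsRationalClass c → Literature.AlgebraicGeometry.HodgeTheory.IsOfHodgeType 4 X (2 * 2) 2 2 c → c ∈ Literature.AlgebraicGeometry.HodgeTheory.algebraicClasses X 2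

/-- item stmt-HodgeConjecture-14600 · crux · rank 4 · open · by planner
why it might fail: Granted HC(4,2) it is HC in the middle degree of every even dim ≥ 6 (BFNP Lem. 48; nothing descends from dim 4 upward): general Weil-type abelian 2n-folds, n ≥ 3, carry non-divisorial Hodge classes (vanGeemen1994 Thm 4.11), algebraic only for disc −1 sixfolds (arXiv:2502.03415).
sources: Deligne2000, BrosnanFangNiePearlstein2009, vanGeemen1994HodgeAV, Markman2025SecantWeil, arXiv:2502.03415, Arapura2022
[crux] THE SUMMIT, GRANTED THE FOURFOLD MIDDLE DEGREE (rank 4; conditional complement beyond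
dimension 4 — D-0027 §2.1 route-repair 2026-08-16: replaces SummitBeyondFourfolds
stmt-HodgeConjecture-14417, whose unconditional form 'every rational middle-degree Hodge class in
every even dimension ≥ 6 is algebraic' implies the whole summit by itself through X ↦ X × ℙ²
(refuter crux-attack, RESTATES-THE-TARGET), and absorbs the print theorems MiddleReduction /
HodgeModels / LefschetzOneOne, which stay as support items = the foreseen stubs of this crux).
Statement: (every rational (2,2)-class on every smooth projective fourfold is algebraic) → for every
n and every smooth projective complex n-fold X, a Hodge model of X exists and every rational
(p,p)-class on X is algebraic — i.e. HodgeConjectureFor n X for all n, X, spelled out. How the line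
reaches it: HodgeModels (conjunct 1: GAGA + de Rham + Hodge decomposition); MiddleReduction (BFNP
Lemma 48: products with projective spaces below the middle, general slices of X × (ℙ¹)^r above it,
reduce everything to the middle degree of even-dimensional varieties); m = 0 trivial
(algebraicClasses_zero), m = 1 Lefschetz (1,1) (LefschetzOneOne), m = -/
@[route_item "route-HodgeConjecture-NoetherLefschetzOneUp", crux]
def SummitGrantedFourfolds : Prop :=
  (∀ ⦃X : Literature.AlgebraicGeometry.Motives.SchemeOver ℂ⦄, Literature.AlgebraicGeometry.Motives.IsSmoothProjective 4 X → ∀ c : Literature.AlgebraicGeometry.HodgeTheory.complexBetti X (2 * 2), Literature.AlgebraicGeometry.HodgeTheory.IsRationalClass c → Literature.AlgebraicGeometry.HodgeTheory.IsOfHodgeType 4 X (2 * 2) 2 2 c → c ∈ Literature.AlgebraicGeometry.HodgeTheory.algebraicClasses X 2) → ∀ ⦃n : ℕ⦄ ⦃X : Literature.AlgebraicGeometry.Motives.SchemeOver ℂ⦄, Literature.AlgebraicGeometry.Motives.IsSmoothProjective n X → Nonempty (Literature.AlgebraicGeometry.HodgeTheory.HodgeModel n X) ∧ ∀ (p : ℕ)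 (c : Literature.AlgebraicGeometry.HodgeTheory.complexBetti X (2 * p)), Literature.AlgebraicGeometry.HodgeTheory.IsRationalClass c → Literature.AlgebraicGeometry.HodgeTheory.IsOfHodgeType n X (2 * p) p p c → c ∈ Literature.AlgebraicGeometry.HodgeTheory.algebraicClasses X p

-- item stmt-HodgeConjecture-11626 · support · rank 4 · open · by planner — informal only, no Lean statement yet:
--   [crux] ENGINES FOR K3TypeNets (card K3; any ONE suffices on its range; informal until the VHS/IC
--   carriers exist). For a K3-type net f : X → ℙ² with transcendental variation 𝕋 and period map φ :
--   ℙ²∖Δ → Γ\D_IV: (e1) SHIMURA-DOMINATED BASES, rk𝕋 ≤ 4 (φ generically finite onto a Shimura curve /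
--   Hilbert modular surface): BLMM / Hirzebruch–Zagier with coefficients (BergeronLiMillsonMoeglin2017;
--   FunkeMillson2006LocalCoefficients; arXiv:1108.5305) + a Lefschetz theorem with twisted coefficients
--   for the finite map give Hdg ∩ I_𝕋 ⊂ φ*(special cycles with coefficients) = NL-Gysin span; (e2)
--   EXPLICIT NL O

/-- item stmt-HodgeConjecture-15374 · support · rank 5 · closed · proved by Summit.HodgeConjecture.HodgeConjecture.Theorems.stub_genericGeometricGenus @ 7e52eaff7eac (prover) · by planner
[crux] GENERIC CONSTANCY OF THE GEOMETRIC GENUS IN A SURFACE NET (rank 5; route-choice 2026-08-16,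
D-0027 A7: the XL-apex Literature fact Motives.fiberNet_exists_hasFibreHodgeNumber = Voisin I Prop.
9.20 for nets, on which the support item NetReduction (stmt-HodgeConjecture-11604) was parked after
four prover seats, PROMOTED to a ranked crux in its MINIMAL form — verbatim the second input of the
landed glue Theorems.netReduction_of_generic_geometricGenus, p107363 — so that the crux protocol may
cut it into 2–7 stubs; non-crux facts are inline-or-verdict). STATEMENT: for every smooth projective
complex fourfold X and every surface net N : Motives.SurfaceNet 2 X over ℙ² (Motives/SurfaceNet)
there are a non-empty Zariski-open V ⊆ U = ℙ² ∖ Δ inside the smooth base and ONE g such that every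
fibre S_b = N.fiber b over a ℂ-point b of V admits a Hodge model A with dim_ℂ A.hodgePQ 2 2 0 = g
(p_g(S_b) = g generically). IN PRINT: b ↦ h⁰(S_b, Ω²) = p_g is upper semicontinuous on U (Hartshorne
III Thm. 12.8; Voisin I Thm. 9.15 / Cor. 9.19, READ PDF pp. 194–197), so its minimum is attained
exactly on a non-empty open V of the irreducible U; and dim A.hodgePQ 2 2 0 = dim K^{2,0}(S_b^an) =
the num -/
@[route_item "route-HodgeConjecture-NoetherLefschetzOneUp"]
def GenericGeometricGenus : Prop :=
  ∀ ⦃X : Literature.AlgebraicGeometry.Motives.SchemeOver ℂ⦄, Literature.AlgebraicGeometry.Motives.IsSmoothProjective 4 X → ∀ N : Literature.AlgebraicGeometry.Motives.SurfaceNet 2 X, ∃ V : (Literature.AlgebraicGeometry.Motives.projectiveSpace 2 ℂ).left.Opens, (V : Set (Literature.AlgebraicGeometry.Motives.projectiveSpace 2 ℂ).left).Nonempty ∧ V ≤ N.smoothBase ∧ ∃ g : ℕ, ∀ b : Literature.AlgebraicGeometry.Motives.AlgPoints (Literature.AlgebraicGeometry.Motives.projectiveSpace 2 ℂ) ℂ,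 b.pt ∈ V → ∃ A : Literature.AlgebraicGeometry.HodgeTheory.HodgeModel 2 (Literature.AlgebraicGeometry.Motives.FiberNet.fiber N b), Module.finrank ℂ ↥(A.hodgePQ 2 2 0) = g

-- `GenericGeometricGenus` holds: proved by `Summit.HodgeConjecture.HodgeConjecture.Theorems.stub_genericGeometricGenus` @ 7e52eaff7eac (its module imports this route file, so no `_holds` link can be stated here).

/-- item stmt-HodgeConjecture-11602 · support · rank 9 · open · by planner
sources: Arapura2022, ConteMurre1978
[support] LEVEL ZERO (theorem in print, Arapura2022 Cor. 1.5, READ p. 5): same statement for nets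
whose general fibre has h^{2,0} = 0 — then R²f_* is spanned after a finite base change by relative
divisors 𝒵_i spread from a divisor basis of H²(X_y) by the relative Hilbert scheme, H²(U, R²) = ⊕
H²(U) ∪ [𝒵_i], and Lefschetz (1,1) on the base finishes (Arapura also recovers Conte–Murre for
uniruled fourfolds). The typed conclusion (algebraic ⊔ vertical) is weaker than the printed one (HC
for X). [difficulty: L] -/
@[route_item "route-HodgeConjecture-NoetherLefschetzOneUp", crux]
def LevelZeroNets : Prop :=
  ∀ ⦃X : Literature.AlgebraicGeometry.Motives.SchemeOver ℂ⦄ (f : X ⟶ Literature.AlgebraicGeometry.Motives.projectiveSpace 2 ℂ), Literature.AlgebraicGeometry.Motives.IsSmoothProjective 4 X → Function.Surjective f.left.base → (∃ T : Set (Literature.AlgebraicGeometry.Motives.projectiveSpace 2 ℂ).left, IsClosed T ∧ T ≠ Set.univ ∧ ∀ s : Literature.AlgebraicGeometry.Motives.AlgPoints (Literature.AlgebraicGeometry.Motives.projectiveSpace 2 ℂ) ℂ, s.pt ∉ T → Literature.AlgebraicGeometry.Motives.IsSmoothProjective 2 (Literature.AlgebraicGeometry.Motives.fiberOver f s) ∧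 ∃ A : Literature.AlgebraicGeometry.HodgeTheory.HodgeModel 2 (Literature.AlgebraicGeometry.Motives.fiberOver f s), Module.finrank ℂ ↥(A.hodgePQ 2 2 0) = 0) → Submodule.span ℂ {c : Literature.AlgebraicGeometry.HodgeTheory.complexBetti X (2 * 2) | Literature.AlgebraicGeometry.HodgeTheory.IsRationalClass c ∧ Literature.AlgebraicGeometry.HodgeTheory.IsOfHodgeType 4 X (2 * 2) 2 2 c} ≤ Literature.AlgebraicGeometry.HodgeTheory.algebraicClasses X 2 ⊔ Submodule.span ℂ {c : Literature.AlgebraicGeometry.HodgeTheory.complexBetti X (2 * 2) | Literature.AlgebraicGeometry.HodgeTheory.IsRationalClass c ∧ Literature.AlgebraicGeometry.HodgeTheory.IsOfHodgeType 4 X (2 * 2) 2 2 c ∧ ∃ T : Set (Literature.AlgebraicGeometry.Motives.projectiveSpace 2 ℂ).left, IsClosed T ∧ T ≠ Set.univ ∧ Literature.AlgebraicGeometry.HodgeTheory.complexBetti.restrictCompl X (f.left.base ⁻¹' T) (2 * 2) c = 0}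

/-- item stmt-HodgeConjecture-11603 · support · rank 9 · closed · proved by Summit.HodgeConjecture.HodgeConjecture.Theorems.stub_verticalHodgeAlgebraic (prover) · by planner
sources: DeligneHodgeIII1974, VoisinHodgeII2003, Zucker1977
[support] VERTICAL HODGE CLASSES ON A FOURFOLD ARE ALGEBRAIC (theorem in print): for X smooth
projective of dimension 4 and f : X → ℙ² surjective, the span of the rational (2,2)-classes
vanishing on X ∖ f⁻¹(C), C ⊊ ℙ² Zariski-closed, lies in algebraicClasses X 2. Proof: ker(H⁴(X) →
H⁴(X ∖ f⁻¹C)) is the sum of the Gysin images of H²(D̃_j)(−1) over resolutions D̃_j of the components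
of the threefold f⁻¹(C) (Deligne, Hodge III 8.2.8); a Hodge class in the image lifts to Hodge
classes on the D̃_j by semisimplicity of polarisable Hodge structures; these are divisor classes
(Lefschetz (1,1)) and push forward to algebraic classes. In-tree path:
SupportedHodgeClassDescent.supportedHodgeClass_mem_algebraicClasses_of_hodgeConjectureFor_lt with
LefschetzOneOne.hodgeClasses_algebraic_of_dim_le_three. This is the item through which the NL-Gysin
classes G_{C,v} (Lefschetz (1,1) on the K3-threefold over an NL curve) become algebraic.
[difficulty: M] -/
@[route_item "route-HodgeConjecture-NoetherLefschetzOneUp", crux]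
def VerticalHodgeAlgebraic : Prop :=
  ∀ ⦃X : Literature.AlgebraicGeometry.Motives.SchemeOver ℂ⦄ (f : X ⟶ Literature.AlgebraicGeometry.Motives.projectiveSpace 2 ℂ), Literature.AlgebraicGeometry.Motives.IsSmoothProjective 4 X → Function.Surjective f.left.base → Submodule.span ℂ {c : Literature.AlgebraicGeometry.HodgeTheory.complexBetti X (2 * 2) | Literature.AlgebraicGeometry.HodgeTheory.IsRationalClass c ∧ Literature.AlgebraicGeometry.HodgeTheory.IsOfHodgeType 4 X (2 * 2) 2 2 c ∧ ∃ T : Set (Literature.AlgebraicGeometry.Motives.projectiveSpace 2 ℂ).left, IsClosed T ∧ T ≠ Set.univ ∧ Literature.AlgebraicGeometry.HodgeTheory.complexBetti.restrictCompl X (f.left.base ⁻¹' T) (2 * 2) c = 0} ≤ Literature.AlgebraicGeometry.HodgeTheory.algebraicClasses X 2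

-- `VerticalHodgeAlgebraic` holds: proved by `Summit.HodgeConjecture.HodgeConjecture.Theorems.stub_verticalHodgeAlgebraic` (its module imports this route file, so no `_holds` link can be stated here).

/-- item stmt-HodgeConjecture-11604 · support · rank 9 · closed · proved by Summit.HodgeConjecture.HodgeConjecture.Theorems.noetherLefschetzOneUp_netReduction @ addf8fa18ef6 (prover) · by planner
sources: Hartshorne1977, VoisinHodgeII2003, Fulton1998
[support] EVERY FOURFOLD ENTERS THROUGH A NET (theorem in print): for X smooth projective of
dimension 4 there are a smooth projective fourfold X' (the blow-up of X along the smooth base curve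
of a general net in |𝒪_X(d)|, Hartshorne II 7.17.3 + Bertini) and a surjective f : X' → ℙ² whose
fibres off a proper Zariski-closed T ⊂ ℙ² are smooth projective surfaces (generic smoothness)
admitting Hodge models with h^{2,0} equal to one CONSTANT g (Hodge numbers are constant in smooth
projective families: Ehresmann + upper semicontinuity + Hodge symmetry), such that algebraicity of
all rational (2,2)-classes of X' implies that of all rational (2,2)-classes of X (σ_* σ^* = id on
H⁴(X), σ^* preserves rational Hodge classes, σ_* preserves algebraic classes). The prover chooses
the net: d ≫ 0 always gives g ≥ 2; g = 1 nets exist on special X (quadric sections of Q⁴, the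
projection of X_(3,4) ⊂ ℙ²×ℙ³, K3-fibred Fano/CY fourfolds), g = 0 on uniruled-type X. [difficulty:
L] -/
@[route_item "route-HodgeConjecture-NoetherLefschetzOneUp"]
def NetReduction : Prop :=
  ∀ ⦃X : Literature.AlgebraicGeometry.Motives.SchemeOver ℂ⦄, Literature.AlgebraicGeometry.Motives.IsSmoothProjective 4 X → ∃ (X' : Literature.AlgebraicGeometry.Motives.SchemeOver ℂ) (f : X' ⟶ Literature.AlgebraicGeometry.Motives.projectiveSpace 2 ℂ), Literature.AlgebraicGeometry.Motives.IsSmoothProjective 4 X' ∧ Function.Surjective f.left.base ∧ (∃ T : Set (Literature.AlgebraicGeometry.Motives.projectiveSpace 2 ℂ).left, IsClosed T ∧ T ≠ Set.univ ∧ ∃ g : ℕ, ∀ s : Literature.AlgebraicGeometry.Motives.AlgPoints (Literature.AlgebraicGeometry.Motives.projectiveSpace 2 ℂ) ℂ, s.pt ∉ T → Literature.AlgebraicGeometry.Motives.IsSmoothProjective 2 (Literature.AlgebraicGeometry.Motives.fiberOver f s) ∧ ∃ A : Literature.AlgebraicGeometry.HodgeTheory.HodgeModel 2 (Literature.AlgebraicGeometry.Motives.fiberOver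 f s), Module.finrank ℂ ↥(A.hodgePQ 2 2 0) = g) ∧ ((∀ c' : Literature.AlgebraicGeometry.HodgeTheory.complexBetti X' (2 * 2), Literature.AlgebraicGeometry.HodgeTheory.IsRationalClass c' → Literature.AlgebraicGeometry.HodgeTheory.IsOfHodgeType 4 X' (2 * 2) 2 2 c' → c' ∈ Literature.AlgebraicGeometry.HodgeTheory.algebraicClasses X' 2) → ∀ c : Literature.AlgebraicGeometry.HodgeTheory.complexBetti X (2 * 2), Literature.AlgebraicGeometry.HodgeTheory.IsRationalClass c → Literature.AlgebraicGeometry.HodgeTheory.IsOfHodgeType 4 X (2 * 2) 2 2 c → c ∈ Literature.AlgebraicGeometry.HodgeTheory.algebraicClasses X 2)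

-- `NetReduction` holds: proved by `Summit.HodgeConjecture.HodgeConjecture.Theorems.noetherLefschetzOneUp_netReduction` @ addf8fa18ef6 (its module imports this route file, so no `_holds` link can be stated here).

-- earlier MiddleReduction (stmt-HodgeConjecture-11605, replaced 2026-08-15T18:30:07Z -> stmt-HodgeConjecture-11624): retired by None — Literature.AlgebraicGeometry.HodgeTheory.middleDimensionReduction
/-- item stmt-HodgeConjecture-11624 · support · rank 9 · closed · proved by Summit.HodgeConjecture.HodgeConjecture.Theorems.middleReduction_proof @ 6e015c1b040b (prover) · by planner
sources: BrosnanFangNiePearlstein2009, KerrPearlstein2011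
[support] REDUCTION TO THE MIDDLE DIMENSION, UNFOLDED (BrosnanFangNiePearlstein2009 Lemma 48;
verbatim the definiens of the Literature named fact middleDimensionReduction, `Iff.rfl` in the
planner Sketch3.lean): if every rational middle-degree Hodge class on every even-dimensional smooth
projective complex variety is algebraic, then every rational (p,p)-class on every smooth projective
variety is. Restated unfolded (rev 1) so that the route cone carries no unproved named-fact constant
(staffable); HOW IT CLOSES: `middleDimensionReduction_of_nonempty_hodgeModel`
(MiddleDimensionReductionOfHodgeModels) from nonempty_hodgeModel, hodgePQ_independent_of_hodgeModel,
CupPreservesHodgeType — products with projective spaces below the middle, general slices of X ×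
(ℙ¹)^r above it. Sources: BrosnanFangNiePearlstein2009, KerrPearlstein2011. -/
@[route_item "route-HodgeConjecture-NoetherLefschetzOneUp"]
def MiddleReduction : Prop :=
  (∀ ⦃m : ℕ⦄ ⦃X : Literature.AlgebraicGeometry.Motives.SchemeOver ℂ⦄, Literature.AlgebraicGeometry.Motives.IsSmoothProjective (2 * m) X → ∀ c : Literature.AlgebraicGeometry.HodgeTheory.complexBetti X (2 * m), Literature.AlgebraicGeometry.HodgeTheory.IsRationalClass c → Literature.AlgebraicGeometry.HodgeTheory.IsOfHodgeType (2 * m) X (2 * m) m m c → c ∈ Literature.AlgebraicGeometry.HodgeTheory.algebraicClasses X m) → ∀ ⦃n : ℕ⦄ ⦃X : Literature.AlgebraicGeometry.Motives.SchemeOver ℂ⦄, Literature.AlgebraicGeometry.Motives.IsSmoothProjective n X → ∀ (p : ℕ) (c : Literature.AlgebraicGeometry.HodgeTheory.complexBetti X (2 * p)), Literature.AlgebraicGeometry.HodgeTheory.IsRationalClass c → Literature.AlgebraicGeometry.HodgeTheory.IsOfHodgeType n X (2 * p) p p c → c ∈ Literature.AlgebraicGeometry.HodgeTheory.algebraicClasses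 X p

-- `MiddleReduction` holds: proved by `Summit.HodgeConjecture.HodgeConjecture.Theorems.middleReduction_proof` @ 6e015c1b040b (its module imports this route file, so no `_holds` link can be stated here).

-- item stmt-HodgeConjecture-11627 · support · rank 9 · open · by planner — informal only, no Lean statement yet:
--   [support] THETA CERTIFICATE LEMMA (card P3; informal until vector-valued modular forms / IC
--   cohomology with coefficients have carriers). For a K3-type net f : X → ℙ² with transcendental
--   variation 𝕋 (even lattice 𝕋_ℤ, discriminant form), period map φ : ℙ²∖Δ → Γ_L\D_IV and a Hodge class
--   ξ ∈ I_𝕋 = im IH²(ℙ², j_!*𝕋) ⊂ H⁴(X,ℚ): the generating series Θ(ξ)(τ) := Σ_{m ≥ 0} ( Σ_{v mod Γ,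
--   −q(v)/2 = m} ⟨ξ, G_{C_v,v}⟩ ) q^m — G_{C_v,v} the NL-Gysin class of the surface swept over the NL
--   curve C_v = φ⁻¹(D_v) by the extra class v, counted with the excess multiplicities of φ(ℙ²) ∩ D_v,
--   constant term the ⟨ξ,

-- item stmt-HodgeConjecture-11640 · support · rank 9 · open · by planner — informal only, no Lean statement yet:
--   [support] BI-TYPE / MUMFORD-TRACE LEMMA (card P2 + the planner observation that positivity (V) is
--   automatic over ℙ²; informal until Hodge modules have carriers). Let f : X → B be a surjective
--   morphism from a smooth projective fourfold onto a smooth projective surface with smooth general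
--   fibre, 𝕋 ⊂ R²f_*ℚ|_U the transcendental sub-variation, λ̄ the canonical extension of F²𝒯 (≅
--   f_*ω_{X/B} modulo the constant part), Δ_u ⊂ Δ the discriminant components with infinite local
--   monodromy. (i) (Saito1990, Popa2017 §4) Gr²_F of I_𝕋 = im IH²(B, j_!*𝕋) ⊂ H⁴(X) is filtered with
--   graded pieces inside H²(B, λ̄

/-- item stmt-HodgeConjecture-16363 · support · rank 9 · open · by planner
why it might fail: A 1971 theorem: only its TYPING can fail — `Continuous σ` (étalé topology of FiberClass) must mean 'flat section' (tree: Lemma 4.17 bridge given Ehresmann trivialisations). Real risk = size: residue Voisin II 4.23 core (Deligne MHS + Hodge II 3.2.17); two discharges bounced.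
sources: DeligneHodgeII1971, VoisinHodgeII2003, CharlesSchnell2014Notes, Deligne1968, Voisin2007HodgeLoci, Arapura2022
[crux] PROMOTED NAMED FACT (route-choice repair 2026-08-16, harness-requested: the Literature fact
`HodgeTheory.deligne_globalInvariantCycles` was judged XL-apex — too large for one prover seat, and
non-crux facts are not split — after two discharge attempts bounced; it is load-bearing for crux
#3's only live line). Deligne's global invariant cycle theorem / théorème de la partie fixe (Hodge
II Thm 4.1.1; Voisin II Thm 4.24; Charles–Schnell Thm 11.3.4), hard inclusion, ℂ-coefficients,
pointwise, on the real carriers of HodgeLocus.lean: for a smooth projective family f : 𝒳 ⟶ S of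
relative dimension n over a smooth quasi-projective complex base (quasi-projectivity INLINED as ∃
open ℂ-immersion into a projective ℂ-scheme — Iff.rfl with HodgeTheory.IsQuasiProjectiveOver S — so
the route imports only HodgeLocus, never the fact file) and an open immersion i : 𝒳 ⟶ 𝒳̄ into a
smooth projective 𝒳̄, every continuous section σ of the étalé space FiberClass f k (a global =
monodromy-invariant section of Rᵏ f_* ℂ) takes at each s₀ the value of the restriction of some A ∈
Hᵏ(𝒳̄(ℂ); ℂ): σ s₀ = globalSection f k (i^* A) s₀. VERBATIM the body of the named fact (planner
SketchIff.lean: Iff.rfl, lean -/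
@[route_item "route-HodgeConjecture-NoetherLefschetzOneUp"]
def DeligneGlobalInvariantCycles : Prop :=
  ∀ (𝒳 Xbar S : Literature.AlgebraicGeometry.Motives.SchemeOver ℂ) (f : 𝒳 ⟶ S) (i : 𝒳 ⟶ Xbar) (n m : ℕ), Literature.AlgebraicGeometry.Motives.IsSmoothProjectiveFamily f n → (∃ (P : Literature.AlgebraicGeometry.Motives.SchemeOver ℂ) (j : S ⟶ P), Literature.AlgebraicGeometry.Motives.IsProjectiveOver P ∧ AlgebraicGeometry.IsOpenImmersion j.left) → AlgebraicGeometry.Smooth S.hom → Literature.AlgebraicGeometry.Motives.IsProjectiveOver Xbar → AlgebraicGeometry.SmoothOfRelativeDimension m Xbar.hom → AlgebraicGeometry.IsOpenImmersion i.left → ∀ (k : ℕ) (σ : Literature.AlgebraicGeometry.Motives.ComplexPoints S → Literature.AlgebraicGeometry.HodgeTheory.FiberClass f k), Continuous σ → (∀ s, (σ s).pt = s) → ∀ s₀ : Literature.AlgebraicGeometry.Motives.ComplexPoints S, ∃ A : Literature.AlgebraicGeometry.HodgeTheory.complexBetti Xbar k, σ s₀ = Literature.AlgebraicGeometry.HodgeTheory.globalSection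 f k (Literature.AlgebraicGeometry.HodgeTheory.complexBetti.map i k A) s₀

/-- item stmt-HodgeConjecture-3050 · support · rank 9 · closed · proved by Summit.HodgeConjecture.HodgeConjecture.Theorems.curveNetMordellWeil_hodgeModels_proof @ a3022ab2aaa0 (prover) · by planner
sources: SerreGAGA1956, VoisinHodgeI2002
[support] Every smooth projective complex variety has a Hodge model (analytification + natural de
Rham comparison + Hodge decomposition): literally ∀ n X,
Literature.AlgebraicGeometry.HodgeTheory.nonempty_hodgeModel n X (named fact,
HodgeModelExistence.lean; conditional assembly nonempty_hodgeModel_of in HodgeModelExistenceProofs).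
Supplies the anti-vacuity conjunct of HodgeConjectureFor in the Assembly. Sources: SerreGAGA1956,
VoisinHodgeI2002 Thm 6.18. -/
@[route_item "route-HodgeConjecture-NoetherLefschetzOneUp"]
def HodgeModels : Prop :=
  ∀ ⦃n : ℕ⦄ ⦃X : Literature.AlgebraicGeometry.Motives.SchemeOver ℂ⦄, Literature.AlgebraicGeometry.Motives.IsSmoothProjective n X → Nonempty (Literature.AlgebraicGeometry.HodgeTheory.HodgeModel n X)

/-- `HodgeModels` holds: proved by `Summit.HodgeConjecture.HodgeConjecture.Theorems.curveNetMordellWeil_hodgeModels_proof` @ a3022ab2aaa0. -/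
theorem HodgeModels_holds : HodgeModels := _root_.Summit.HodgeConjecture.HodgeConjecture.Theorems.curveNetMordellWeil_hodgeModels_proof

/-- item stmt-HodgeConjecture-8544 · support · rank 9 · closed · proved by Summit.HodgeConjecture.HodgeConjecture.Theorems.lefschetzOneOne_proof @ d83ad61a979b (prover) · by planner
sources: VoisinHodgeI2002, Deligne2000
[support] LEFSCHETZ'S THEOREM ON (1,1)-CLASSES, rational form = the Literature NAMED FACT, filed as
an item of this route by the cone route-repair (2026-08-15) to mark it as GENUINELY NEEDED tier-0
debt. needs-fact: Literature.AlgebraicGeometry.HodgeTheory.lefschetzOneOne_rational (file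
Literature/AlgebraicGeometry/HodgeTheory/LefschetzOneOne.lean; Voisin I Thm. 11.30 + Lelong Thm.
11.33 + GAGA Cor. 11.34, §11.3.3; exponential sequence). Statement VERBATIM that fact (complexBetti
is an abbrev of singularCohomology ℂ ℂ (ComplexPoints X)): for X smooth projective of dimension n
over ℂ, every rational class c ∈ H²(X(ℂ);ℂ) of Hodge type (1,1) lies in algebraicClasses X 1 = N¹H²
(the span of divisor classes). ROLE: the q = 1 base of the Assembly's induction on codimension (the
'Mordell–Weil bottom' of the thesis); the Assembly currently takes the fact itself as its first
antecedent. HOW TO CLOSE: prove/discharge the fact IN LITERATURE (literature-prover seats), then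
close this item by the one-liner `theorem lefschetzOneOne_item :
…CurveNetMordellWeil.LefschetzOneOne := fun n X hX c hc h ↦ <fact>_holds hX c hc h` in Theorems/; do
NOT attempt a problem-side proof of Lefschetz (1,1). REROU -/
@[route_item "route-HodgeConjecture-NoetherLefschetzOneUp", crux]
def LefschetzOneOne : Prop :=
  ∀ ⦃n : ℕ⦄ ⦃X : Literature.AlgebraicGeometry.Motives.SchemeOver ℂ⦄, Literature.AlgebraicGeometry.Motives.IsSmoothProjective n X → ∀ c : Literature.AlgebraicGeometry.HodgeTheory.complexBetti X (2 * 1), Literature.AlgebraicGeometry.HodgeTheory.IsRationalClass c → Literature.AlgebraicGeometry.HodgeTheory.IsOfHodgeType n X (2 * 1) 1 1 c → c ∈ Literature.AlgebraicGeometry.HodgeTheory.algebraicClasses X 1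

/-- `LefschetzOneOne` holds: proved by `Summit.HodgeConjecture.HodgeConjecture.Theorems.lefschetzOneOne_proof` @ d83ad61a979b. -/
theorem LefschetzOneOne_holds : LefschetzOneOne := _root_.Summit.HodgeConjecture.HodgeConjecture.Theorems.lefschetzOneOne_proof

-- earlier Assembly (stmt-HodgeConjecture-11607, replaced 2026-08-16T03:04:26Z -> stmt-HodgeConjecture-14134): retired by None — K3TypeNets → GeneralTypeNets → LevelZeroNets → VerticalHodgeAlgebraic → NetReduction → MiddleReduction → HodgeModels → LefschetzOneOne → SummitBeyondFourfolds → _root_.HodgeConjecture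
-- earlier Assembly (stmt-HodgeConjecture-14134, replaced 2026-08-16T03:22:56Z -> stmt-HodgeConjecture-14416): retired by None — K3TypeNets → GeneralTypeNets → LevelZeroNets → VerticalHodgeAlgebraic → NetReduction → MiddleReduction → HodgeModels → LefschetzOneOne → MiddleDegreeBeyondFourfolds → _root_.HodgeConjecture
-- earlier Assembly (stmt-HodgeConjecture-14416, replaced 2026-08-16T04:01:18Z -> stmt-HodgeConjecture-14598): retired by None — K3TypeNets → GeneralTypeNets → LevelZeroNets → VerticalHodgeAlgebraic → NetReduction → MiddleReduction → HodgeModels → LefschetzOneOne → SummitBeyondFourfolds → _root_.HodgeConjecture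
/-- item stmt-HodgeConjecture-14598 · assembly · rank 1 · open · by planner
sources: Arapura2022, BrosnanFangNiePearlstein2009, Deligne2000
[assembly] FRAME ITEM #1 · X → Statement — 'it suffices to show X = K3TypeNets': K3TypeNets →
HodgeConjecture. Restated 2026-08-16 (route-repair) from the nine-arrow chain that was literally the
type of the old deciding theorem; it is NOT pure logic now (the sufficiency is the content of the
two conditional complement cruxes) and is proved by `fun h ↦ SummitGrantedFourfolds_holds
(FourfoldsGrantedK3Nets_holds h)` — i.e. `fun h ↦ hS (h4 h)` — once FourfoldsGrantedK3Nets and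
SummitGrantedFourfolds land. The deciding theorem is `closes : K3TypeNets → FourfoldsGrantedK3Nets →
SummitGrantedFourfolds → HodgeConjecture` (crux-only). [deps: K3TypeNets, FourfoldsGrantedK3Nets,
SummitGrantedFourfolds] [difficulty: open-problem] -/
@[route_item "route-HodgeConjecture-NoetherLefschetzOneUp"]
def Assembly : Prop :=
  K3TypeNets → _root_.HodgeConjecture

-- records of items no longer active in this route (dropped / restated):
-- earlier SummitBeyondFourfolds (stmt-HodgeConjecture-11606, replaced 2026-08-16T03:03:41Z -> stmt-HodgeConjecture-14123): retired by None — ∀ ⦃m : ℕ⦄ ⦃X : Literature.AlgebraicGeometry.Motives.SchemeOver ℂ⦄, 3 ≤ m → Literature.AlgebraicGeometry.Motives.IsSmoothProjective (2 * m) X → ∀ c : Literature.AlgebraicGeometry.HodgeTheory.complexBetti X (2 * m), Literature.AlgebraicGeometry.HodgeTheory.IsRati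

/-! D-0027 §2.1 — DECIDING THEOREM (planner-authored via `route open/edit --closes-file`; by planner-rbadge-HodgeConjecture-NoetherLefschet-8ba4d6b7-g2-0 2026-08-16T04:01:18Z):
its hypotheses are this route's items and its conclusion the sub-problem Statement (glue_lint), and it elaborates with this file. -/

@[closes "route-HodgeConjecture-NoetherLefschetzOneUp"] theorem closes (hK3 : K3TypeNets) (h4 : FourfoldsGrantedK3Nets)
    (hS : SummitGrantedFourfolds) : _root_.HodgeConjecture := by
  -- the K3-type net sector feeds the fourfold middle degree (h4), which feeds the rest of the summit (hS)
  intro n X hX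
  exact ⟨(hS (h4 hK3) hX).1, (hS (h4 hK3) hX).2⟩

end Summit.HodgeConjecture.HodgeConjecture.Theses.NoetherLefschetzOneUp
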